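import Summits.BirchSwinnertonDyer.BirchSwinnertonDyer.Theorems.ClassRecordThreeCornerAtThreeBranches
import Summits.BirchSwinnertonDyer.BirchSwinnertonDyer.Theses.KolyvaginRoadThree

/-!
# BC3 skeleton — crux 7 `CornerAtThree` (item stmt-BirchSwinnertonDyer-19111; K2@3 `ClassRecordThree` rank 7, shared BY STATEMENT
# with `KolyvaginRoadThree`) — line `Lines/birth.lean` (corner-p1 g7; for the planner to `crux write` + `skeleton check`)

WHY A SKELETON AND NOT A SPLIT (plan g30 EDIT END 05:32:37Z lesson on HalvesAtThreeR): the item is shared by statement between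
two routes and K2@3 is at the 7-crux cap, so the (Tw)@3 decomposition is recorded as a REGISTERED SKELETON whose stubs are the
four Theses-free children of `Theorems/ClassRecordThreeCornerAtThreeBranchesDefs.lean` (p488767) BY NAME plus the 13-fact
bundle `KatoTwinFactsThreeAn` (text = HOME/corner/g7/KatoTwinFactsThreeAn.txt, f3a1f8bc706d7d91), and whose composition
is corner-p1 g6's glue `Theorems.cornerAtThree_of_branchesAn` (p489722). Each child stub has its OWN finer kit in
HOME/corner/g7/bc3/ (StepL = oriented halves bee9aab9; Upper = J₃ᶜ max∕multi + inputs b9a9fbfe; TwistLower by sign 4d2f3687;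
TwistMuAn v2 non-split-unit CLOSED ∕ non-unit ∕ split b05cf46c) for the day a child becomes its own item.
Stubs (5 ≤ stubs_max): `stub_cornerStepL3` · `stub_cornerUpper3` · `stub_cornerTwistLower3` · `stub_cornerTwistMuAn3` ·
`stub_cornerFacts3` (named print facts only — never proved here; the planner may replace it by a by-name support item).
`CornerAtThree_of` ⊢ the K2@3 ROUTE decl; `CornerAtThreeKoly_of` ⊢ the KOLY route decl (same term; the KOLY decl is a
by-statement copy). Sorries only in `stub_*`. Nothing is asserted about any curve (T7).
-/

set_option linter.dupNamespace false
set_option autoImplicit false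

namespace Summit.BirchSwinnertonDyer.BirchSwinnertonDyer.Cruxes.CornerAtThree.Birth

/-- **stub StepL** — conjunct 1 on the corner: `∀ W, Three.CornerStepLAt W` (S0-currency STEP L at 3; kit: oriented halves). -/
theorem stub_cornerStepL3 : Summit.BirchSwinnertonDyer.BirchSwinnertonDyer.Theorems.CornerAtThreeStepL := by
  sorry

/-- **stub Upper** — conjunct 3: the Tamagawa-sharp Kolyvagin bound over K (kit: J₃ᶜ max ∕ multi + inputs over g4's kernel theorem). -/
theorem stub_cornerUpper3 : Summit.BirchSwinnertonDyer.BirchSwinnertonDyer.Theorems.CornerAtThreeUpper := by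
  sorry

/-- **stub TwistLower** — the 3-part lower bound at every odd Heegner twin (kit: by sign; Skinner 2016 void — no (ram)). -/
theorem stub_cornerTwistLower3 : Summit.BirchSwinnertonDyer.BirchSwinnertonDyer.Theorems.CornerAtThreeTwistLower := by
  sorry

/-- **stub TwistMuAn** — analytic μ = 0 at 3 at every odd Heegner twin (kit v2: non-split unit-value CLOSED p499490, non-unit, split). -/
theorem stub_cornerTwistMuAn3 : Summit.BirchSwinnertonDyer.BirchSwinnertonDyer.Theorems.CornerAtThreeTwistMuAn := by
  sorry

/-- **stub Facts** — the bundle `KatoTwinFactsThreeAn`: thirteen NAMED print facts (Stein–Wuthrich Thm 6.1 ×2, GZK, entire L,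
parametrisation supply, Greenberg–Stevens, Kato nonempty_iwasawaH1Data ∕ Thm 12.4 ∕ §17.13 inputs non-split ∕ split, Greenberg 1999
Thm 1.5 (mult, rational), Wuthrich 2014 Cor 18, Kato §17.13 fine). Facts are hypotheses by name; this stub is never «proved». -/
theorem stub_cornerFacts3 : (Literature.NumberTheory.EllipticCurves.SteinWuthrich2013.thm61_splitMultiplicative ∧ Literature.NumberTheory.EllipticCurves.SteinWuthrich2013.thm61_nonsplitMultiplicative ∧ Literature.NumberTheory.EllipticCurves.rank_eq_analyticRank_of_analyticRank_le_one ∧ WeierstrassCurve.hasEntireLFunction_rat ∧ Literature.NumberTheory.EllipticCurves.ModularForms.nonempty_modularParametrizationData ∧ (∀ (W : WeierstrassCurve ℚ) [W.IsElliptic] [W.IsGloballyMinimal] (p : ℕ) [Fact p.Prime], Literature.NumberTheory.EllipticCurves.greenberg_stevens W p) ∧ Literature.NumberTheory.EllipticCurves.Kato2004.nonempty_iwasawaH1Data ∧ Literature.NumberTheory.EllipticCurves.Kato2004.thm12_4 ∧ Literature.NumberTheory.EllipticCurves.Kato2004.exists_multDivisibilityInputs_nonsplit ∧ Literature.NumberTheory.EllipticCurves.Kato2004.exists_multDivisibilityInputs_split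 ∧ Literature.NumberTheory.EllipticCurves.Greenberg1999.thm15_isTorsion_multiplicative_rat ∧ Literature.NumberTheory.EllipticCurves.Wuthrich2014.corollary18_padicLFunction_mem_iwasawaAlgebra_multiplicative ∧ Literature.NumberTheory.EllipticCurves.Kato2004.exists_multDivisibilityInputs_fine) := by
  sorry

/-! ## Stub statements by name -/

namespace Statement

/-- Statement of `stub_cornerStepL3`. -/
abbrev stub_cornerStepL3 : Prop := type_of% @Birth.stub_cornerStepL3
/-- Statement of `stub_cornerUpper3`. -/
abbrev stub_cornerUpper3 : Prop := type_of% @Birth.stub_cornerUpper3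
/-- Statement of `stub_cornerTwistLower3`. -/
abbrev stub_cornerTwistLower3 : Prop := type_of% @Birth.stub_cornerTwistLower3
/-- Statement of `stub_cornerTwistMuAn3`. -/
abbrev stub_cornerTwistMuAn3 : Prop := type_of% @Birth.stub_cornerTwistMuAn3
/-- Statement of `stub_cornerFacts3`. -/
abbrev stub_cornerFacts3 : Prop := type_of% @Birth.stub_cornerFacts3

end Statement

/-! ## The composition (sorry-free): the five stub STATEMENTS imply the crux, BY NAME, on BOTH routes -/

/-- **`CornerAtThree_of`** — corner-p1 g6's glue `Theorems.cornerAtThree_of_branchesAn` (p489722) ⊢ the K2@3 ROUTE decl. -/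
theorem CornerAtThree_of (hS : Statement.stub_cornerStepL3) (hU : Statement.stub_cornerUpper3)
    (hL : Statement.stub_cornerTwistLower3) (hμ : Statement.stub_cornerTwistMuAn3) (hF : Statement.stub_cornerFacts3) :
    Summit.BirchSwinnertonDyer.BirchSwinnertonDyer.Theses.ClassRecordThree.CornerAtThree :=
  Summit.BirchSwinnertonDyer.BirchSwinnertonDyer.Theorems.cornerAtThree_of_branchesAn hS hU hL hμ hF

/-- **`CornerAtThreeKoly_of`** — the same term ⊢ the KOLY route's by-statement copy of the crux. -/
theorem CornerAtThreeKoly_of (hS : Statement.stub_cornerStepL3) (hU : Statement.stub_cornerUpper3)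
    (hL : Statement.stub_cornerTwistLower3) (hμ : Statement.stub_cornerTwistMuAn3) (hF : Statement.stub_cornerFacts3) :
    Summit.BirchSwinnertonDyer.BirchSwinnertonDyer.Theses.KolyvaginRoadThree.CornerAtThree :=
  Summit.BirchSwinnertonDyer.BirchSwinnertonDyer.Theorems.cornerAtThree_of_branchesAn hS hU hL hμ hF

/-- The crux along this line (K2@3), MODULO exactly the five stubs (sorries only in `stub_*`). -/
theorem CornerAtThree_proof : Summit.BirchSwinnertonDyer.BirchSwinnertonDyer.Theses.ClassRecordThree.CornerAtThree :=
  CornerAtThree_of stub_cornerStepL3 stub_cornerUpper3 stub_cornerTwistLower3 stub_cornerTwistMuAn3 stub_cornerFacts3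

/-- The crux along this line (KOLY), MODULO exactly the five stubs. -/
theorem CornerAtThreeKoly_proof : Summit.BirchSwinnertonDyer.BirchSwinnertonDyer.Theses.KolyvaginRoadThree.CornerAtThree :=
  CornerAtThreeKoly_of stub_cornerStepL3 stub_cornerUpper3 stub_cornerTwistLower3 stub_cornerTwistMuAn3 stub_cornerFacts3

end Summit.BirchSwinnertonDyer.BirchSwinnertonDyer.Cruxes.CornerAtThree.Birth
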